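import Mathlib
import HarnessLib
import HarnessLib.Audit
import Summits.CriticalPhenomena.Statement

/-!
Route: PercNonSelfAveraging

# Route PercNonSelfAveraging — a jump makes the critical arm mass self-average; one Binder-type
ratio Var/E² ≥ c at p_c forces θ(p_c) = 0

It suffices to show X = ArmMassNSA (card
CriticalPhenomena/PercolationContinuityZ3/self-averaging-binder-criterion, its crux NSA):
NON-SELF-AVERAGING OF THE CRITICAL ARM MASS. Let B(n) = [−n,n]³, A_x^{(n)} = {x ↔ ∂^{in}B(2n) by an
open path inside B(2n)}
(a local, increasing, B(2n)-measurable event) and M_n = #{x ∈ B(n) : A_x^{(n)}} = Σ_{x∈B(n)}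
1_{A_x^{(n)}} the ARM MASS of the
box at p = p_c(ℤ³) (bond percolation, zdGraph 3, criticalProbI 3). X: there is c > 0 with
Var_{p_c}(M_n) ≥ c (E_{p_c} M_n)² for
INFINITELY MANY n — the Binder-type reduced second cumulant R_n = Var/E² of the arm mass does not
tend to 0 at p_c. X is one crux;
the route also files two stronger engines (StrictMacroscopicFKG, ArmMassLowerTail) with their
one-line ladders to X, and the
provable-now support SelfAveragingUnderJump (θ(p) > 0 ⇒ R_n(p) → 0) that closes the assembly by pure
logic.
Lean: `∃ c : ℝ, 0 < c ∧ ∃ᶠ n : ℕ in Filter.atTop, c * (∫ ω, (∑ x ∈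
Literature.Probability.LatticeModels.box 3 n, Set.indicator {ω' | ∃ y ∈
Literature.Probability.LatticeModels.innerBoundary (Literature.Probability.LatticeModels.zdGraph 3)
(Literature.Probability.LatticeModels.box 3 (2 * n)), ω' ∈
Literature.Probability.Percolation.openConnIn ↑(Literature.Probability.LatticeModels.box 3 (2 * n))
x y} (fun _ => (1 : ℝ)) ω) ∂(Literature.Probability.Percolation.bondPercolation
(Literature.Probability.LatticeModels.zdGraph 3) (Literature.Probability.Percolation.criticalProbI
3))) ^ 2 ≤ ProbabilityTheory.variance (fun ω => ∑ x ∈ Literature.Probability.LatticeModels.box 3 n,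
Set.indicator {ω' | ∃ y ∈ Literature.Probability.LatticeModels.innerBoundary
(Literature.Probability.LatticeModels.zdGraph 3) (Literature.Probability.LatticeModels.box 3 (2 *
n)), ω' ∈ Literature.Probability.Percolation.openConnIn ↑(Literature.Probability.LatticeModels.box 3
(2 * n)) x y} (fun _ => (1 : ℝ)) ω) (Literature.Probability.Percolation.bondPercolation
(Literature.Probability.LatticeModels.zdGraph 3) (Literature.Probability.Percolation.criticalProbI
3))`

## Assembly
Pure logic given the support lemma (checked sorry-free in Sketch.lean): suppose θ(p_c) = theta
(zdGraph 3) 0 (criticalProbI 3) ≠ 0;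
then θ(p_c) > 0 (measureReal_nonneg), so SelfAveragingUnderJump at p = criticalProbI 3 with the
constant c of ArmMassNSA gives
EVENTUALLY Var(M_n) < c (E M_n)², while ArmMassNSA gives FREQUENTLY c (E M_n)² ≤ Var(M_n);
Filter.Frequently.and_eventually yields
∃ᶠ n, False, absurd (Filter.frequently_false). Hence theta (zdGraph 3) 0 (criticalProbI 3) = 0, i.e.
PercolationContinuityZ3
(percolationContinuityZ3_iff). The engines enter only through the ladders: StrictMacroscopicFKG → X,
ArmMassLowerTail → X,
CritAnnulusNonCrossing → ArmMassLowerTail.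

Rationale: WHY THIS LINE. A jump is a law of large numbers: if θ(p_c) = θ* > 0, then #{x ∈ B(n) : |C(x)| = ∞} ≤
M_n ≤ |B(n)| with E M_n ≤ θ_n(p_c)|B(n)|
and θ_n ↓ θ*, and the covariances Cov(1{|C(x)|=∞}, 1{|C(y)|=∞}) tend to 0 as |x−y| → ∞ (approximate
{|C(0)|=∞} by the local
event {0 ↔ ∂B(m)}: error θ_m − θ* in L¹, and local arm events of far-apart sites use disjoint edge
sets), so Var(M_n) = o(|B(n)|²)
= o((E M_n)²): the arm mass SELF-AVERAGES in every jump world (the density LLN of Grimmett1999 §7.4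
(7.100)–(7.101), read
contrapositively in the observable of HeydenreichVanDerHofstad2017 (13.3.31), p_c^{(3)} = argmax
Var|C_max|/(E|C_max|)²). Hence
ANY positive lower bound on the universal finite-size fluctuation ratio R_n at p_c gives θ(p_c) = 0
in five lines. R_n ≥ c is a
THEOREM in d = 2 (RSW: P(M_n = 0) ≥ c, Grimmett1999 §11.7) and FALSE for d > 6 (≈ n^{d−6}
proliferating spanning clusters make
M_n a sum of many independent pieces, R_n ≍ n^{6−d}; Aizenman1997 Thms 4–5), so X is exactly the d <
6 / hyperscaling input
(BorgsChayesKestenSpencer1999) in its cheapest form: one second-moment inequality about one bounded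
local observable at one
value of p, numerically decidable (FSS lore: the spanning-cluster mass has a broad universal law at
p_c,
doi:10.1051/jphyslet:01984004509040100, doi:10.1103/physreve.89.042103). Imported areas: ergodic
theory of Bernoulli shifts
(mixing/LLN, used only through independence of disjointly supported local events),
finite-size-scaling phenomenology of
statistical physics (Binder cumulants) as the source of the crux, Harris–FKG/BK correlation calculus
for the ladders. Versus
prior routes: X is strictly WEAKER than X_B = CritAnnulusNonCrossing of route PercAnnulusCrossing
(X_B ⇒ P(M_n=0) ≥ c ⇒
ArmMassLowerTail ⇒ X) and survives crossing probabilities → 1; it needs no free-box folklore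
(PercHyperscalingGluing,
PercNonProliferation), no supercritical moment hypothesis, no second parameter; the negatives index
(1 SAW item) is untouched.

RANKED CRUXES. #2 ArmMassNSA (crux) — X itself (card crux NSA, rank 2): ∃ c > 0 such that for
infinitely many n, Var_{p_c}(M_n) ≥ c (E_{p_c} M_n)², where M_n(ω) = Σ_{x ∈ box 3 n} 1{∃ y ∈
innerBoundary (zdGraph 3) (box 3 (2n)), ω ∈ openConnIn ↑(box 3 (2n)) x y} is the number of sites of
B(n) joined to ∂^{in}B(2n) inside B(2n), under μ = bondPercolation (zdGraph 3) (criticalProbI 3);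
Var = ProbabilityTheory.variance. Heuristic size: E M_n ≍ n^{3−β/ν}, Var ≍ n⁶ τ_{p_c}(n) ≍
n^{6−(1+η)}, equal orders iff hyperscaling 2β/ν = 1+η (d=3: 0.954 both sides numerically); X says
the leading orders do not cancel, i.e. R_n → R* > 0, a universal amplitude ratio of 3D percolation
FSS. [difficulty: open-problem] (why it might fail: Fails iff the critical arm mass is
asymptotically deterministic — as in every jump world (this route's lemma), in d>6 (R_n≍n^{6−d},
Aizenman1997 Thm 4–5) and on 1/r² chains; in d=3 only FSS numerics (broad universal spanning-mass
law) say R*>0; no rigorous fluctuation LOWER bound at p_c known.) [Aizenman1997,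
BorgsChayesKestenSpencer1999, HeydenreichVanDerHofstad2017, Grimmett1999,
doi:10.1051/jphyslet:01984004509040100, doi:10.1103/physreve.89.042103,
doi:10.1103/physrevlett.95.185702, arXiv:1302.0421]
#3 StrictMacroscopicFKG (crux) — STRICT MACROSCOPIC FKG for far pairs (card crux StrictFKG,
pointwise engine E3): ∃ c > 0 such that for all large n and all x, y ∈ B(n) at sup-distance ≥ n/2 (∃
i, 2|x_i − y_i| ≥ n), P_{p_c}(A_x^{(n)} ∩ A_y^{(n)}) ≥ (1 + c) · P_{p_c}(A_x^{(n)}) ·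
P_{p_c}(A_y^{(n)}), with A_x^{(n)} = {x ↔ ∂^{in}B(2n) inside B(2n)}. Harris–FKG gives ≥ 1 always
(both events increasing); the ratio splits as (same-cluster term P(x ↔ y ↔ ∂B(2n)))/(P(A_x)P(A_y)) +
(different-clusters term)/(P(A_x)P(A_y)), the second ≤ 1 by BK, the first ≍ τ_{p_c}(n)/θ_n² = O(1)
under hyperscaling and → 0 for d > 6; strictness says the BK deficit does not exactly absorb the
same-cluster amplitude. Implies ArmMassNSA (support StrictFKGLadder). [difficulty: open-problem]
(why it might fail: The far-pair ratio is (same-cluster amplitude)+(disjoint-arm factor ≤1 by BK);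
FKG only forces the sum ≥1 and it IS 1+o(1) for d>6 and in any jump world (mixing); strictness in
d=3 is a universal-amplitude statement with no known rigorous handle — expected, never estimated.)
[Harris1960, Grimmett1999, Literature.Probability.Percolation.harris_fkg_holds,
BorgsChayesKestenSpencer1999, Aizenman1997, arXiv:cond-mat/9805125]
#4 ArmMassLowerTail (crux) — LOWER TAIL of the critical arm mass (card crux LowerTail, blocking-type
engine E1): ∃ c > 0 such that for infinitely many n, P_{p_c}(M_n ≤ ½ E_{p_c} M_n) ≥ c — with
probability bounded below the box B(n) carries at most half its expected arm mass. Implied by X_B =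
CritAnnulusNonCrossing of route PercAnnulusCrossing (stmt-CriticalPhenomena-0846: on {B(n) ↮ ∂B(2n)
in B(2n)}, M_n = 0; support AnnulusLadder) but strictly weaker: it tolerates P_{p_c}(B(n) ↔ ∂B(2n))
→ 1 provided the crossing clusters are occasionally thin. Implies ArmMassNSA with constant c/4
(support LowerTailLadder). In d = 2 it holds by RSW (closed dual circuit in the annulus w.p. ≥ c).
[difficulty: open-problem] (why it might fail: Needs few-arms configurations w.p. ≥ c at infinitely
many scales: weaker than X_B but of the same RSW flavour — false for d>6 (box spanned w.h.p. by
≈n^{d−6} clusters of concentrated total mass, Aizenman1997 Thm 4) and open in d=3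
(NewmanTassionWu2017: slabs only, c(k)→0).) [NewmanTassionWu2017, Aizenman1997, Grimmett1999,
Tassion2016, arXiv:1512.05178]
#9 SelfAveragingUnderJump (support) — SELF-AVERAGING LEMMA (the engine of the assembly; card support
SelfAveragingUnderJump + SandwichZM; provable now over PROVED library facts). For every p ∈ [0,1]
with θ(p) = theta (zdGraph 3) 0 p > 0 and every c > 0: for all large n, Var_p(M_n) < c (E_p M_n)².
Proof (elementary, no ergodic theorem): write A_x = A_x^{(n)}, C_x = {|C(x)| = ∞} = percolatesAt x,
L_x^m = {x ↔ ∂^{in}(x+B(m)) inside x+B(m)} = DCT16.armEvent x m, θ_k = P_p(0 ↔ ∂^{in}B(k) in B(k))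
(= real (siteToBoundary 3 k)). (i) SANDWICH: for x ∈ B(n), C_x ⊆ A_x a.s. (an open path from x to a
point outside B(2n) first meets ∂^{in}B(2n); configurations are a.s. subsets of E(ℤ³)) and A_x ⊆
L_x^n (first exit from x+B(n) ⊆ B(2n); cf. DCT16.armEvent_of_pathIn), so θ(p) ≤ P(A_x) ≤ θ_n
(DCT16.real_armEvent, DCT16.theta_le_real_siteToBoundary) and ‖1_{A_x} − 1_{C_x}‖_{L¹} ≤ θ_n − θ(p);
likewise ‖1_{C_x} − 1_{L_x^m}‖_{L¹} = θ_m − θ(p). (ii) θ_k ↓ θ(p): antitone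
(DCT16.real_siteToBoundary_antitone), ⋂_k {0↔∂B(k)} = C_0 up to a null set
(DCT16.iInter_siteToBoundary_subset_percolatesAt and (i)), continuity from above of μ
(measurableSet_percolatesAt_holds, DCT16.measurableSet_openConnIn). (iii) For indicator-type f, f',
g, g' with values in [0,1]: |Cov(f,g) − Cov(f',g')| ≤ 2‖f−f'‖₁ + 2‖g−g'‖₁. (iv) INDEPENDENCE AT
DISTANCE: if |x − y|_∞ > 2m the events L_x^m, L_y^m are determined by the disjoint edge sets inside
x+B(m), y+B(m), so Cov(1_{L_x^m}, 1_{L_y^m}) = 0 (DCT16.real_inter_of_determinedBy_disjoint,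
DCT16.determinedBy_openConnIn). Hence for x, y ∈ B(n): Cov(1_{A_x},1_{A_y}) ≤ 4(θ_n − θ) + 4(θ_m −
θ) + 1{|x−y|_∞ ≤ 2m}, and summing, Var_p(M_n) = Σ_{x,y∈B(n)} Cov(1_{A_x},1_{A_y}) ≤
|B(n)|²·(4(θ_n−θ) + 4(θ_m−θ)) + |B(n)|(4m+1)³, while E_p M_n ≥ θ(p)|B(n)| > 0. Given c: choose m
with 4(θ_m − θ) ≤ cθ²/4 (θ = θ(p)), then N with 4(θ_n − θ) ≤ cθ²/4 and (4m+1)³ ≤ cθ²|B(n)|/4 for n ≥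
N; then Var_p(M_n) ≤ (3c/4)θ²|B(n)|² < c (E_p M_n)². (Variance of a finite sum of bounded indicators
= double sum of covariances: ProbabilityTheory.variance_def' / IndepFun-free algebra; all events
measurable, all functions bounded by |B(n)|.) [difficulty: provable-now] [Grimmett1999,
NewmanSchulman1981, Literature.Probability.Percolation.DCT16.real_inter_of_determinedBy_disjoint,
Literature.Probability.Percolation.DCT16.real_armEvent,
Literature.Probability.Percolation.DCT16.real_siteToBoundary_antitone,
Literature.Probability.Percolation.DCT16.iInter_siteToBoundary_subset_percolatesAt,
Literature.Probability.Percolation.measurableSet_percolatesAt_holds]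
#9 LowerTailLadder (support) — ArmMassLowerTail → ArmMassNSA (card ladder, spelled out). Proof: at
every n with P(M_n ≤ E/2) ≥ c (E = E_{p_c}M_n ≥ 0): Var(M_n) = ∫ (M_n − E)² dμ ≥ ∫_{M_n ≤ E/2} (M_n
− E)² dμ ≥ P(M_n ≤ E/2)·(E/2)² ≥ (c/4) E²; so NSA holds with constant c/4 along the same infinitely
many n. Needs: M_n measurable and bounded (finite sum of indicators of measurable events,
DCT16.measurableSet_openConnIn), variance of a bounded r.v. under a probability measure = ∫ (X − E
X)² (ProbabilityTheory.variance_def' or evariance_eq_lintegral_ofReal + integrability of bounded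
functions). [difficulty: provable-now] [Grimmett1999,
Summits/CriticalPhenomena/PercolationContinuityZ3/Ideas/self-averaging-binder-criterion.md]
#9 StrictFKGLadder (support) — StrictMacroscopicFKG → ArmMassNSA (card ladder 'StrictFKG ⇒ NSA',
spelled out with the comparability step the card omits). Proof: Var(M_n) = Σ_{x,y ∈ B(n)} [P(A_x ∩
A_y) − P(A_x)P(A_y)]; EVERY term is ≥ 0 by Harris–FKG (A_x increasing: harris_fkg_holds /
harris_fkg_lower); far pairs (∃ i, 2|x_i−y_i| ≥ n) contribute ≥ c P(A_x)P(A_y) each for n ≥ N.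
Comparability: for x ∈ B(n), θ_{3n} ≤ P(A_x) ≤ θ_n (x+B(3n) ⊇ B(2n) ⊇ x+B(n); first-exit arguments
as in DCT16.armEvent_of_pathIn, translation invariance DCT16.real_armEvent), and for each x ∈ B(n)
at most n³ ≤ |B(n)|/8 sites y ∈ B(n) are NOT far (all |x_i−y_i| ≤ (n−1)/2), so #far ≥ (7/8)|B(n)|².
Hence Var(M_n) ≥ (7c/8)|B(n)|² θ_{3n}² ≥ (7c/8)(θ_{3n}/θ_n)² (E M_n)². Finally θ_{3n} ≥ θ_n/10 for
INFINITELY MANY n: otherwise θ_{3^k N'} < 10^{−k} for all k, contradicting the PROVED critical lower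
bound θ_n(p_c) ≥ a/n²
(Literature.Barriers.CriticalPhenomena.exists_oneArmProb_criticalProbI_lower_sq, d = 3: a/(3^k N')²
= (a/N'²)9^{−k} > 10^{−k} for large k). At those n (all ≥ N eventually) NSA holds with constant
7c/800. [difficulty: provable-now] [Harris1960, Literature.Probability.Percolation.harris_fkg_holds,
Literature.Barriers.CriticalPhenomena.exists_oneArmProb_criticalProbI_lower_sq, KozmaNachmias2011,
DuminilCopinTassionEM2016]
#9 AnnulusLadder (support) — CritAnnulusNonCrossing → ArmMassLowerTail, where the antecedent is
VERBATIM the crux X_B of route PercAnnulusCrossing (stmt-CriticalPhenomena-0846: ∃ c > 0, ∀ n ≥ 1,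
P_{p_c}(∃ x ∈ B(n), ∃ y ∈ ∂^{in}B(2n), x ↔ y inside B(2n)) ≤ 1 − c). Proof: the crossing event is
measurable (finite union of DCT16.measurableSet_openConnIn), so its complement has probability ≥ c
(prob_compl_eq_one_sub); on the complement no x ∈ B(n) is joined to ∂^{in}B(2n) inside B(2n), i.e.
every indicator in M_n vanishes and M_n = 0 ≤ E M_n / 2 (E M_n ≥ 0). Hence P(M_n ≤ E/2) ≥ c for all
n ≥ 1, in particular frequently. Records that X is weaker than X_B: a proof of
stmt-CriticalPhenomena-0846 closes this route too. [difficulty: provable-now] [NewmanTassionWu2017,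
Grimmett1999, Summits/CriticalPhenomena/PercolationContinuityZ3/Theses/PercAnnulusCrossing.lean]

TWO-LAYER PLAN. Foreseen glued splits (none filed now; k ≤ 3, depth 1). ArmMassNSA ⇐ OneFatCluster →
FatClusterMassAnticoncentration → ArmMassNSA
(engine E2 of the card: with probability ≥ c one open cluster of B(2n) carries ≥ c·E M_n of the arm
mass, and the conditional
variance of that cluster's mass given the configuration outside B(n/4) is ≥ c (E M_n)² — a
same-scale gluing/ungluing statement
'flipping O(1) edges near a near-pivotal bottleneck attaches/detaches a macroscopic piece'; glue =
law of total variance).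
ArmMassNSA ⇐ ArmMassUpperTail (P(M_n ≥ (1+c)E M_n) ≥ c i.o., 'occasionally one fat spanning
cluster', needs no crossing to
fail) → ArmMassNSA (Chebyshev-free, as LowerTailLadder). StrictMacroscopicFKG ⇐ SameClusterAmplitude
(P(x ↔ y ↔ ∂B(2n)) ≥
c₂ P(A_x)P(A_y) for far pairs, a gluing/hyperscaling statement) → BKDeficitNotSaturated (P(A_x ∘
A_y) ≥ (1 − c₂ + c) P(A_x)P(A_y))
→ StrictMacroscopicFKG. ArmMassLowerTail ⇐ the RSW inputs of PercAnnulusCrossing (BlockerRSW3D +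
CubeBlockingSeed ⇒ X_B ⇒
AnnulusLadder), shared, not refiled.

KILL CRITERIA. ¬ArmMassNSA (R_n → 0 at p_c(ℤ³) proved, e.g. from an unexpected CLT-scale
concentration of the arm mass) closes the route outright
(close --reason refuted:ArmMassNSA): the criterion is then void in the real world although θ(p_c)=0
may still hold — and it would
refute a standard piece of FSS lore, worth reporting upward. ¬StrictMacroscopicFKG alone (ratio → 1
along far pairs) or
¬ArmMassLowerTail alone (arm mass never macroscopically depleted) each kill one engine only: drop
that crux (route edit --drop),
keep X. A proof of CritAnnulusNonCrossing (stmt-0846) elsewhere proves X via the ladders and moots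
the engines; PercolationContinuityZ3
proved elsewhere moots everything. A refuter's observation that X ⇒ X_B-type blocking after all
would downgrade the route to a
restatement of PercAnnulusCrossing (I claim not: X allows P(M_n = 0) → 0).

NOT DECOMPOSED YET. Engine E2 (one fat cluster + anti-concentration by local resampling; needs a
typed conditional-variance / resampling statement
over setBernoulli restricted to the edges of B(n/4)) and ArmMassUpperTail — layer-2 children of X,
filed only if X stalls;
the p ↑ p_c transfer (Var_p(M_n), E_p M_n are polynomials in p; attack X at p_c − n^{−θ} and move by
|∂_p| ≤ C n^{9/2}-type
bounds); the negative bookkeeping E4 of the card (level-1/Poincaré/Efron–Stein variance LOWER bounds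
give only V_n ≥ c n³(∂_pθ̃_n)²,
too weak by the CCFS gap — recorded so nobody retries); site version; other monster-dominated
observables (#{x ∈ B(n): x ↔ ∂B(kn)},
|C_max ∩ B(n)|) for which the same lemma holds; constants (1/2 in LowerTail, n/2 in 'far', aspect
ratio 2) are immaterial and
may be changed by `--restate` if a prover needs it.

CHEAPEST FALSIFIER. One union-find Monte Carlo (Newman–Ziff), bond percolation on ℤ³ at p =
0.2488118 (arXiv:1302.0421), boxes B(2n) with n = 8, 16,
32, 64 (128 if cheap), 10⁴ samples each: record M_n = #{x ∈ B(n) : x ↔ ∂^{in}B(2n) inside B(2n)},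
report R_n = Var/E² with
bootstrap errors and the fit R_n = R* + b n^{−ω}; ALSO the far-pair FKG ratio
P(A_x∩A_y)/(P(A_x)P(A_y)) for (x,y) = (±n/2·e₁)
and P(M_n ≤ E/2), P(M_n = 0). Prediction: R_n plateaus at R* > 0 (NSA alive), FKG ratio → const > 1,
P(M_n ≤ E/2) → const > 0.
A clean decay R_n ∝ n^{−a}, a > 0, retires the card and closes the route. NOT run here: the hub is
compute-free and the compute
socket was absent this session (kit compute nodes: 'computed socket absent'); first refuter/prover
with kit access should run it
(≈ 1 cpu-hour in numpy).

NUMBERS. p_c(ℤ³, bond) = 0.24881182(10); wrapping probability R^{(x)}_c = 0.25780(6) ∈ (0,1); d_f =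
2.52293(10), so β/ν = 3 − d_f = 0.47707
under hyperscaling (arXiv:1302.0421); η = −0.046(3), 2β/ν = 1 + η = 0.954 (arXiv:cond-mat/9805125) —
hence E M_n ≍ n^{2.52},
Var M_n ≍ n^{6−0.954} = n^{5.05} ≍ (E M_n)², R_n ≍ n^0: the exponents allow R* > 0 and X is the
statement that the amplitude is
positive. d > 6 (η = 0): E M_n ≍ n^{d−2}, Var ≍ n^{d+2}, R_n ≍ n^{6−d} → 0; ≈ n^{d−6} spanning
clusters, spanning probability → 1
(Aizenman1997 Thm 4). d = 2: P_{1/2}(M_n = 0) ≥ P(closed dual circuit in A(n,2n)) ≥ c (RSW,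
Grimmett1999 §11.7), so R_n ≥ c and
P(≥ k spanning clusters) ≤ e^{−αk²} (Aizenman1997 Thm 3). Jump world: R_n → 0 (this route's lemma,
any p with θ(p) > 0).
Critical one-arm lower bound used by StrictFKGLadder: θ_n(p_c) ≥ a/n² on ℤ³ (PROVED,
exists_oneArmProb_criticalProbI_lower_sq;
KozmaNachmias2011 Lemma 3.1 via DuminilCopinTassionEM2016 φ_{p_c}(S) ≥ 1). Items at open: 8 (3
cruxes, 4 supports, assembly).

DEFINITION REQUESTS. None. bondPercolation, openConnIn, theta, criticalProbI, percolatesAt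
(Literature.Probability.Percolation), box, innerBoundary,
zdGraph, Site (Literature.Probability.LatticeModels) and ProbabilityTheory.variance (Mathlib) exist;
the arm mass is written inline
as Σ_{x ∈ box 3 n} Set.indicator {ω | ∃ y ∈ innerBoundary (zdGraph 3) (box 3 (2n)), ω ∈ openConnIn
↑(box 3 (2n)) x y} 1 ω (no
decidability instance needed). A prover may introduce `armMass n ω` locally with --supports.

Novelty: Searches (2026-08-15, this planner; searchd FTS leg reset/timeout ×2, OpenAlex/S2/arXiv HTTP 429 —
recorded in NOTES.md):
`lit search --hybrid "self-averaging percolation threshold variance spanning cluster mass order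
parameter distribution"` (12 held
books: Landau–Binder 2021 pp. 64–66, Christensen–Moloney, Stauffer-type texts — FSS phenomenology,
no criterion); `lit search
--source all "Binder cumulant percolation universal ratio order parameter distribution three
dimensions"` (crossref 10: Malakis–Fytas
PRE 89 (2014) 042103 doi:10.1103/physreve.89.042103 'critical Binder cumulant … FK clusters and
order-parameter distribution',
Botet–Płoszajczak PRL 95 (2005) 185702, Lee PRE 53 (1996) amplitude ratios; local: arXiv:0705.1320
DP moment ratio); `lit search
--source all "lack of self-averaging percolation threshold spanning cluster mass fluctuations"`
(searchd down); `lit galaxy search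
"mass of the spanning cluster" --star all` (8 rows: Feder, Stauffer–Aharony, Malthe-Sørenssen —
textbooks); `lit galaxy search
"self-averaging" --star pdf --title-contains percolation` (10 rows, none on critical 3D
percolation); `lit frontier CriticalPhenomena
--since 2021` (30 rows; nothing on arm-mass or spanning-mass fluctuations at p_c(ℤ³)); READ
HeydenreichVanDerHofstad2017 p.170
(13.3.30)–(13.3.31) + Open Problem 13.1 and Grimmett1999 §7.4 p.189 (7.99)–(7.103); the card's and
the refuter novelty audit's
searches (crossref/zbMATH 'self-averaging percolation threshold', 'Binder discontinuou  [refs: 10.1103/physreve.89.042103, 0705.1320, doi:10.1103/physreve.89.042103, HeydenreichVanDerHofstad2017, Grimmett1999, NewmanSchulman1981]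

Barriers (technique_class: ergodic-LLN fluctuation-lower-bound FSS second-moment): - technique_class: ergodic-LLN fluctuation-lower-bound FSS second-moment
- Literature.Barriers.CriticalPhenomena.LongRangeDiscontinuity: PASSED by construction, and it
shapes the crux — SelfAveragingUnderJump uses only independence, translation invariance and Følner
boxes, so it holds verbatim for the Aizenman–Newman 1/r² chains (amenable, translation-invariant,
independent), where θ jumps: there the analogue of ArmMassNSA is FALSE. Hence X cannot be proved by
range/dimension-insensitive means; any proof must use d ≥ 2 nearest-neighbour structure
(hyperscaling-type input), exactly what the barrier demands of the extra ingredient.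
- Literature.Barriers.CriticalPhenomena.SpanningClustersAboveSix: APPLIES to all three cruxes and is
embraced — under (t-c) with η = 0, d > 6, proliferation (N_L ≈ L^{d−6}) makes M_n a sum of many
nearly independent cluster masses, R_n ≍ n^{6−d} → 0, the far-pair FKG ratio → 1 and the lower tail
fails; the cruxes are d < 6 statements by design (they hold in d = 2 by RSW) and a d-uniform proof
attempt is a kill criterion.
- Literature.Barriers.CriticalPhenomena.RandomClusterFirstOrder: not met by the assembly (Bernoulli
only), but informative: for the wired critical random-cluster measure with q ≫ 1 on ℤ³ (first order,
percolating) the infinite-cluster density also self-averages (extremal Gibbs/mixing), so the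
q-analogue of X fails there — a proof of X must be q = 1-specific (independence/BK), not
FKG-generic.
- Literature.Barriers.CriticalPhenomena.T

History (route lifecycle, newest last):
- 2026-08-23T17:08:32Z · DORMANT — reconciler: no traction for 6.1 d (last activity item-evidence-added at 2026-08-17T13:24:09Z); parked, not closed — `ledger route dormant route-CriticalPhenomen (operator:999:3791354)
- 2026-08-23T23:18:19Z · REACTIVATED — reconciler: reactivated — activity statement-closed at 2026-08-23T22:07:53Z after parking at 2026-08-23T17:08:32Z (operator:999:1863232)

sub-problem: PercolationContinuityZ3 · status: open · opened planner-plancard-CriticalPhenomena-Percolatio-079ef81c-0 2026-08-15T12:00:44Z · rev 4 · ledger route-CriticalPhenomena-PercNonSelfAveraging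
GENERATED by the gate from the ledger (D-0016/17). Provers cite these decls: `theorem foo : Summit.CriticalPhenomena.PercolationContinuityZ3.Theses.PercNonSelfAveraging.<Decl> := …` in Summits/CriticalPhenomena/PercolationContinuityZ3/Theorems/<Name>.lean.
-/

namespace Summit.CriticalPhenomena.PercolationContinuityZ3.Theses.PercNonSelfAveraging

open scoped BigOperators Topology Manifold Classical MeasureTheory ProbabilityTheory Matrix InnerProductSpace ComplexConjugate ContinuousMap
open Filter Set Function TopologicalSpace MeasureTheory

attribute [summit_statement] _root_.PercolationContinuityZ3

/-- item stmt-CriticalPhenomena-7058 · crux · rank 2 · open · by planner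
why it might fail: Strictly stronger than θ(p_c)=0: fails whenever M_n concentrates at p_c — as in every jump world (route lemma), for d>6 (R_n≍n^{6−d}; Aizenman1997 Thm 4–5, BCKS2001) and on 1/r² chains; in d=3 R*>0 rests only on hyperscaling/FSS numerics (Kapitulnik–Frid–Deutscher 1984), no rigorous Var lower bound.
sources: Aizenman1997, BorgsChayesKestenSpencer1999, doi:10.1007/s002200100521, doi:10.1051/jphyslet:01984004509040100, HeydenreichVanDerHofstad2017, Grimmett1999
[crux] X itself (card crux NSA, rank 2): ∃ c > 0 such that for infinitely many n, Var_{p_c}(M_n) ≥ c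
(E_{p_c} M_n)², where M_n(ω) = Σ_{x ∈ box 3 n} 1{∃ y ∈ innerBoundary (zdGraph 3) (box 3 (2n)), ω ∈
openConnIn ↑(box 3 (2n)) x y} is the number of sites of B(n) joined to ∂^{in}B(2n) inside B(2n),
under μ = bondPercolation (zdGraph 3) (criticalProbI 3); Var = ProbabilityTheory.variance. Heuristic
size: E M_n ≍ n^{3−β/ν}, Var ≍ n⁶ τ_{p_c}(n) ≍ n^{6−(1+η)}, equal orders iff hyperscaling 2β/ν = 1+η
(d=3: 0.954 both sides numerically); X says the leading orders do not cancel, i.e. R_n → R* > 0, a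
universal amplitude ratio of 3D percolation FSS. [difficulty: open-problem] -/
@[route_item "route-CriticalPhenomena-PercNonSelfAveraging"]
def ArmMassNSA : Prop :=
  ∃ c : ℝ, 0 < c ∧ ∃ᶠ n : ℕ in Filter.atTop, c * (∫ ω, (∑ x ∈ Literature.Probability.LatticeModels.box 3 n, Set.indicator {ω' | ∃ y ∈ Literature.Probability.LatticeModels.innerBoundary (Literature.Probability.LatticeModels.zdGraph 3) (Literature.Probability.LatticeModels.box 3 (2 * n)), ω' ∈ Literature.Probability.Percolation.openConnIn ↑(Literature.Probability.LatticeModels.box 3 (2 * n)) x y} (fun _ => (1 : ℝ)) ω) ∂(Literature.Probability.Percolation.bondPercolation (Literature.Probability.LatticeModels.zdGraph 3) (Literature.Probability.Percolation.criticalProbI 3))) ^ 2 ≤ ProbabilityTheory.variance (fun ω => ∑ x ∈ Literature.Probability.LatticeModels.box 3 n, Set.indicator {ω' | ∃ y ∈ Literature.Probability.LatticeModels.innerBoundary (Literature.Probability.LatticeModels.zdGraph 3) (Literature.Probability.LatticeModels.box 3 (2 * n)), ω' ∈ Literature.Probability.Percolation.openConnIn ↑(Literature.Probability.LatticeModels.box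 3 (2 * n)) x y} (fun _ => (1 : ℝ)) ω) (Literature.Probability.Percolation.bondPercolation (Literature.Probability.LatticeModels.zdGraph 3) (Literature.Probability.Percolation.criticalProbI 3))

/-- item stmt-CriticalPhenomena-7059 · crux · rank 3 · open · by planner
why it might fail: Far-pair ratio = same-cluster amplitude + disjoint-arms factor (≤1 by BK); Harris–FKG gives only ≥1 and it IS 1+o(1) for d>6 and under mixing in a jump world; Talagrand/Keller–Mossel–Sen quantitative FKG bounds Cov by joint influences of unknown size at p_c(ℤ³): uniform strictness unestimated.
sources: Harris1960, Grimmett1999, Literature.Probability.Percolation.harris_fkg_holds, doi:10.1007/bf01844850, arXiv:1206.1210, BorgsChayesKestenSpencer1999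
[crux] STRICT MACROSCOPIC FKG for far pairs (card crux StrictFKG, pointwise engine E3): ∃ c > 0 such
that for all large n and all x, y ∈ B(n) at sup-distance ≥ n/2 (∃ i, 2|x_i − y_i| ≥ n),
P_{p_c}(A_x^{(n)} ∩ A_y^{(n)}) ≥ (1 + c) · P_{p_c}(A_x^{(n)}) · P_{p_c}(A_y^{(n)}), with A_x^{(n)} =
{x ↔ ∂^{in}B(2n) inside B(2n)}. Harris–FKG gives ≥ 1 always (both events increasing); the ratio
splits as (same-cluster term P(x ↔ y ↔ ∂B(2n)))/(P(A_x)P(A_y)) + (different-clusters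
term)/(P(A_x)P(A_y)), the second ≤ 1 by BK, the first ≍ τ_{p_c}(n)/θ_n² = O(1) under hyperscaling
and → 0 for d > 6; strictness says the BK deficit does not exactly absorb the same-cluster
amplitude. Implies ArmMassNSA (support StrictFKGLadder). [difficulty: open-problem] -/
@[route_item "route-CriticalPhenomena-PercNonSelfAveraging"]
def StrictMacroscopicFKG : Prop :=
  ∃ c : ℝ, 0 < c ∧ ∀ᶠ n : ℕ in Filter.atTop, ∀ x ∈ Literature.Probability.LatticeModels.box 3 n, ∀ y ∈ Literature.Probability.LatticeModels.box 3 n, (∃ i : Fin 3, (n : ℤ) ≤ 2 * |x i - y i|) → (1 + c) * ((Literature.Probability.Percolation.bondPercolation (Literature.Probability.LatticeModels.zdGraph 3) (Literature.Probability.Percolation.criticalProbI 3)).real {ω | ∃ z ∈ Literature.Probability.LatticeModels.innerBoundary (Literature.Probability.LatticeModels.zdGraph 3) (Literature.Probability.LatticeModels.box 3 (2 * n)), ω ∈ Literature.Probability.Percolation.openConnIn ↑(Literature.Probability.LatticeModels.box 3 (2 * n)) x z} * (Literature.Probability.Percolation.bondPercolation (Literature.Probability.LatticeModels.zdGraph 3)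 (Literature.Probability.Percolation.criticalProbI 3)).real {ω | ∃ z ∈ Literature.Probability.LatticeModels.innerBoundary (Literature.Probability.LatticeModels.zdGraph 3) (Literature.Probability.LatticeModels.box 3 (2 * n)), ω ∈ Literature.Probability.Percolation.openConnIn ↑(Literature.Probability.LatticeModels.box 3 (2 * n)) y z}) ≤ (Literature.Probability.Percolation.bondPercolation (Literature.Probability.LatticeModels.zdGraph 3) (Literature.Probability.Percolation.criticalProbI 3)).real ({ω | ∃ z ∈ Literature.Probability.LatticeModels.innerBoundary (Literature.Probability.LatticeModels.zdGraph 3) (Literature.Probability.LatticeModels.box 3 (2 * n)), ω ∈ Literature.Probability.Percolation.openConnIn ↑(Literature.Probability.LatticeModels.box 3 (2 * n)) x z} ∩ {ω | ∃ z ∈ Literature.Probability.LatticeModels.innerBoundary (Literature.Probability.LatticeModels.zdGraph 3) (Literature.Probability.LatticeModels.box 3 (2 * n)), ω ∈ Literature.Probability.Percolation.openConnIn ↑(Literature.Probability.LatticeModels.box 3 (2 * n)) y z})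

/-- item stmt-CriticalPhenomena-7060 · crux · rank 4 · open · by planner
why it might fail: Needs depletion M_n ≤ E M_n/2 w.p. ≥ c at infinitely many scales — RSW-flavoured: true in d=2 (dual circuits), false for d>6 (box spanned w.h.p. by ≈n^{d−6} clusters of concentrated mass, Aizenman1997 Thm 4), open in d=3: crossing bounds exist only in slabs (NewmanTassionWu2017, arXiv:1512.05178).
sources: NewmanTassionWu2017, arXiv:1512.05178, Aizenman1997, Grimmett1999, Tassion2016, doi:10.1007/s002200100521
[crux] LOWER TAIL of the critical arm mass (card crux LowerTail, blocking-type engine E1): ∃ c > 0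
such that for infinitely many n, P_{p_c}(M_n ≤ ½ E_{p_c} M_n) ≥ c — with probability bounded below
the box B(n) carries at most half its expected arm mass. Implied by X_B = CritAnnulusNonCrossing of
route PercAnnulusCrossing (stmt-CriticalPhenomena-0846: on {B(n) ↮ ∂B(2n) in B(2n)}, M_n = 0;
support AnnulusLadder) but strictly weaker: it tolerates P_{p_c}(B(n) ↔ ∂B(2n)) → 1 provided the
crossing clusters are occasionally thin. Implies ArmMassNSA with constant c/4 (support
LowerTailLadder). In d = 2 it holds by RSW (closed dual circuit in the annulus w.p. ≥ c).
[difficulty: open-problem] -/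
@[route_item "route-CriticalPhenomena-PercNonSelfAveraging"]
def ArmMassLowerTail : Prop :=
  ∃ c : ℝ, 0 < c ∧ ∃ᶠ n : ℕ in Filter.atTop, c ≤ (Literature.Probability.Percolation.bondPercolation (Literature.Probability.LatticeModels.zdGraph 3) (Literature.Probability.Percolation.criticalProbI 3)).real {ω | (∑ x ∈ Literature.Probability.LatticeModels.box 3 n, Set.indicator {ω' | ∃ y ∈ Literature.Probability.LatticeModels.innerBoundary (Literature.Probability.LatticeModels.zdGraph 3) (Literature.Probability.LatticeModels.box 3 (2 * n)), ω' ∈ Literature.Probability.Percolation.openConnIn ↑(Literature.Probability.LatticeModels.box 3 (2 * n)) x y} (fun _ => (1 : ℝ)) ω) ≤ (∫ ω', (∑ x ∈ Literature.Probability.LatticeModels.box 3 n, Set.indicator {ω'' | ∃ y ∈ Literature.Probability.LatticeModels.innerBoundary (Literature.Probability.LatticeModels.zdGraph 3) (Literature.Probability.LatticeModels.box 3 (2 * n)), ω'' ∈ Literature.Probability.Percolation.openConnIn ↑(Literature.Probability.LatticeModels.box 3 (2 * n)) x y} (fun _ => (1 : ℝ)) ω') ∂(Literature.Probability.Percolation.bondPercolation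 (Literature.Probability.LatticeModels.zdGraph 3) (Literature.Probability.Percolation.criticalProbI 3))) / 2}

/-- item stmt-CriticalPhenomena-18189 · crux · rank 5 · open · by planner
why it might fail: Fails iff Var(M_n)=o(E[Σ_C m_C²]) eventually: BK between distinct spanning clusters saturated AND cluster masses concentrated — the jump-world mechanism (SelfAveragingUnderJump) if spanning clusters stay few; d=3 evidence = FSS numerics only (Kapitulnik–Frid–Deutscher 1984).
sources: doi:10.1051/jphyslet:01984004509040100, Aizenman1997, BorgsChayesKestenSpencer1999, HeydenreichVanDerHofstad2017, Grimmett1999, arXiv:1302.0421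
[crux] SQUARED-CLUSTER-MOMENT LOWER BOUND (piece X1 of the BC2-redirect split of ArmMassNSA;
strategist cstrat-7058): ∃ c > 0 such that for all large n, c · Σ_{x,y ∈ B(n)} P_{p_c}(x ↔ ∂⁻B(2n)
and x ↔ y, both inside B(2n)) ≤ Var_{p_c}(M_n), M_n = #{x ∈ B(n) : x ↔ ∂⁻B(2n) inside B(2n)} the arm
mass. The double sum is E[Q_n] with Q_n = Σ_C m_C² over the spanning box-clusters C of B(2n)
(clusters of the configuration restricted to B(2n) meeting B(n) and ∂⁻B(2n); m_C = #(C ∩ B(n))),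
while M_n = Σ_C m_C. By BK, Cov(1_{A_x},1_{A_y}) ≤ P(A_x ∩ A_y ∩ {x ↔ y in B(2n)}), so Var(M_n) ≤
E[Q_n] always; X1 says the BK deficit Σ_{x,y}[P(A_x)P(A_y) − P(A_x ∩ A_y ∩ {x ↮ y})] does not
asymptotically cancel E[Q_n] — number and masses of the spanning clusters fluctuate non-degenerately
(a universal FSS amplitude ratio). Glue (PROVED, evidence Split.lean on stmt-7058, rc0 sorry-free):
ClusterMassAnticoncentration → NonProliferation → ArmMassNSA by a two-case argument at a common good
scale — lower tail {M_n ≤ E/2} w.p. ≥ c/2 ⇒ Chebyshev backwards, else Cauchy–Schwarz over the ≤ M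
classes of armed sites on {N_n ≤ M} ∩ {M_n > E/2}: M_n² ≤ M·Q_n. Heuristics: true in d = 2 (RSW,
quasi-multiplicativity); pla -/
@[route_item "route-CriticalPhenomena-PercNonSelfAveraging"]
def ClusterMassAnticoncentration : Prop :=
  ∃ c : ℝ, 0 < c ∧ ∀ᶠ n : ℕ in Filter.atTop, c * (∑ x ∈ Literature.Probability.LatticeModels.box 3 n, ∑ y ∈ Literature.Probability.LatticeModels.box 3 n, (Literature.Probability.Percolation.bondPercolation (Literature.Probability.LatticeModels.zdGraph 3) (Literature.Probability.Percolation.criticalProbI 3)).real ({ω | ∃ z ∈ Literature.Probability.LatticeModels.innerBoundary (Literature.Probability.LatticeModels.zdGraph 3) (Literature.Probability.LatticeModels.box 3 (2 * n)), ω ∈ Literature.Probability.Percolation.openConnIn ↑(Literature.Probability.LatticeModels.box 3 (2 * n)) x z} ∩ Literature.Probability.Percolation.openConnIn ↑(Literature.Probability.LatticeModels.box 3 (2 * n)) x y)) ≤ ProbabilityTheory.variance (fun ω => ∑ x ∈ Literature.Probability.LatticeModels.box 3 n, Set.indicator {ω' | ∃ y ∈ Literature.Probability.LatticeModels.innerBoundary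 (Literature.Probability.LatticeModels.zdGraph 3) (Literature.Probability.LatticeModels.box 3 (2 * n)), ω' ∈ Literature.Probability.Percolation.openConnIn ↑(Literature.Probability.LatticeModels.box 3 (2 * n)) x y} (fun _ => (1 : ℝ)) ω) (Literature.Probability.Percolation.bondPercolation (Literature.Probability.LatticeModels.zdGraph 3) (Literature.Probability.Percolation.criticalProbI 3))

/-- item stmt-CriticalPhenomena-4444 · crux · rank 6 · open · by planner
why it might fail: Fails iff annulus-spanning box-clusters proliferate at p_c(Z^3): TRUE for d>6 given eta=0 (Aizenman1997 Thm 4(3): N_L>=o(1)L^(d-6); Lean numSpanning_ge_tendsto_one; uncond. d>=11). d=3 tightness = BCKS postulate ('not clear for d=3,4,5', Aizenman Sec.1), numerics only (Sen 1996); no counting tool.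
sources: Aizenman1997, BorgsChayesKestenSpencer1999, Cerf2015, DuminilcopinKozmaTassion2020, FitznerVanDerHofstad2017, HeydenreichVanDerHofstad2017
[crux] at p_c(ℤ³) there are M ∈ ℕ and c > 0 such that for infinitely many n, with probability ≥ c at
most M distinct clusters of the open subgraph induced on B(2n) meet both B(n) and ∂⁻B(2n) (card item
r2, positive-probability form; the '1−ε tightness' and bounded-mean forms imply it). [difficulty:
open-problem] -/
@[route_item "route-CriticalPhenomena-PercNonSelfAveraging"]
def NonProliferation : Prop :=
  ∃ (M : ℕ) (c : ℝ), 0 < c ∧ ∃ᶠ n : ℕ in Filter.atTop, c ≤ (Literature.Probability.Percolation.bondPercolation (Literature.Probability.LatticeModels.zdGraph 3) (Literature.Probability.Percolation.criticalProbI 3)).real {ω | ¬ ∃ x : Fin (M + 1) → Literature.Probability.LatticeModels.Site 3, (∀ i, x i ∈ Literature.Probability.LatticeModels.box 3 n) ∧ (∀ i, ∃ y ∈ Literature.Probability.LatticeModels.innerBoundary (Literature.Probability.LatticeModels.zdGraph 3) (Literature.Probability.LatticeModels.box 3 (2 * n)), ω ∈ Literature.Probability.Percolation.openConnIn ↑(Literature.Probability.LatticeModels.box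 3 (2 * n)) (x i) y) ∧ ∀ i j, i ≠ j → ω ∉ Literature.Probability.Percolation.openConnIn ↑(Literature.Probability.LatticeModels.box 3 (2 * n)) (x i) (x j)}

/-- item stmt-CriticalPhenomena-18330 · support · rank 9 · closed · proved by Summit.CriticalPhenomena.PercolationContinuityZ3.Theorems.ArmMassNSASplit.armMassNSAOfSplit_proof @ a1a8cc20c498 (prover) · by planner
[support] GLUE of the BC2-redirect decomposition of the deciding crux (strategist cstrat-7058):
ClusterMassAnticoncentration → NonProliferation → ArmMassNSA. PROVED, provable-now for a prover:
complete sorry-free file SplitGlue.lean / Split.lean attached as evidence (theorem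
armMassNSA_of_anticoncentration_of_nonProliferation + 3-line wrapper armMassNSAOfSplit_proof; lean
check rc0, axioms propext/Classical.choice/Quot.sound; Theorems/ is prover-only for planners).
Proof: at a scale n where NonProliferation's event G = {no M+1 pairwise-unjoined armed points of
B(n)} has P(G) ≥ c and c₁·E[Q_n] ≤ Var(M_n) (frequently ∧ eventually): either P(G ∖ {M_n > E M_n/2})
≥ c/2 and Chebyshev read backwards (div_four_mul_sq_integral_le_variance_of_lowerTail) gives Var ≥
(c/8)(E M_n)², or P(G ∩ {M_n > E M_n/2}) ≥ c/2 and Cauchy–Schwarz over the ≤ M classes of armed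
sites (MeanCauchySchwarz.card_sq_le_card_image_mul_sum + exists_transversal: M_n² ≤ M·Q_n pointwise
on G) gives (E M_n/2)²·(c/2) ≤ (M+1)·E[Q_n] ≤ (M+1)·Var/c₁; constant min(c₁,1)·c/(8(M+1)).
Registered line: Cruxes/ArmMassNSA/Lines/split_nonproliferation.lean (ArmMassNSA_of). [difficulty:
provable-now] [Aizenman1997, BorgsChayesKestenS -/
@[route_item "route-CriticalPhenomena-PercNonSelfAveraging"]
def ArmMassNSAOfSplit : Prop :=
  ClusterMassAnticoncentration → NonProliferation → ArmMassNSA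

/-- item stmt-CriticalPhenomena-7061 · support · rank 9 · closed · proved by Summit.CriticalPhenomena.PercolationContinuityZ3.Theorems.selfAveragingUnderJump_proof @ e6edc0185a25 (prover) · by planner
sources: Grimmett1999, NewmanSchulman1981, Literature.Probability.Percolation.DCT16.real_inter_of_determinedBy_disjoint, Literature.Probability.Percolation.DCT16.real_armEvent, Literature.Probability.Percolation.DCT16.real_siteToBoundary_antitone, Literature.Probability.Percolation.DCT16.iInter_siteToBoundary_subset_percolatesAt
[support] SELF-AVERAGING LEMMA (the engine of the assembly; card support SelfAveragingUnderJump +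
SandwichZM; provable now over PROVED library facts). For every p ∈ [0,1] with θ(p) = theta (zdGraph
3) 0 p > 0 and every c > 0: for all large n, Var_p(M_n) < c (E_p M_n)². Proof (elementary, no
ergodic theorem): write A_x = A_x^{(n)}, C_x = {|C(x)| = ∞} = percolatesAt x, L_x^m = {x ↔
∂^{in}(x+B(m)) inside x+B(m)} = DCT16.armEvent x m, θ_k = P_p(0 ↔ ∂^{in}B(k) in B(k)) (= real
(siteToBoundary 3 k)). (i) SANDWICH: for x ∈ B(n), C_x ⊆ A_x a.s. (an open path from x to a point
outside B(2n) first meets ∂^{in}B(2n); configurations are a.s. subsets of E(ℤ³)) and A_x ⊆ L_x^n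
(first exit from x+B(n) ⊆ B(2n); cf. DCT16.armEvent_of_pathIn), so θ(p) ≤ P(A_x) ≤ θ_n
(DCT16.real_armEvent, DCT16.theta_le_real_siteToBoundary) and ‖1_{A_x} − 1_{C_x}‖_{L¹} ≤ θ_n − θ(p);
likewise ‖1_{C_x} − 1_{L_x^m}‖_{L¹} = θ_m − θ(p). (ii) θ_k ↓ θ(p): antitone
(DCT16.real_siteToBoundary_antitone), ⋂_k {0↔∂B(k)} = C_0 up to a null set
(DCT16.iInter_siteToBoundary_subset_percolatesAt and (i)), continuity from above of μ
(measurableSet_percolatesAt_holds, DCT16.measurableSet_openConnIn). (iii) For indicator-type f, f',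
g, -/
@[route_item "route-CriticalPhenomena-PercNonSelfAveraging"]
def SelfAveragingUnderJump : Prop :=
  ∀ p : unitInterval, 0 < Literature.Probability.Percolation.theta (Literature.Probability.LatticeModels.zdGraph 3) 0 p → ∀ c : ℝ, 0 < c → ∀ᶠ n : ℕ in Filter.atTop, ProbabilityTheory.variance (fun ω => ∑ x ∈ Literature.Probability.LatticeModels.box 3 n, Set.indicator {ω' | ∃ y ∈ Literature.Probability.LatticeModels.innerBoundary (Literature.Probability.LatticeModels.zdGraph 3) (Literature.Probability.LatticeModels.box 3 (2 * n)), ω' ∈ Literature.Probability.Percolation.openConnIn ↑(Literature.Probability.LatticeModels.box 3 (2 * n)) x y} (fun _ => (1 : ℝ)) ω) (Literature.Probability.Percolation.bondPercolation (Literature.Probability.LatticeModels.zdGraph 3) p) < c * (∫ ω, (∑ x ∈ Literature.Probability.LatticeModels.box 3 n, Set.indicator {ω' | ∃ y ∈ Literature.Probability.LatticeModels.innerBoundary (Literature.Probability.LatticeModels.zdGraph 3) (Literature.Probability.LatticeModels.box 3 (2 * n)), ω' ∈ Literature.Probability.Percolation.openConnIn ↑(Literature.Probability.LatticeModels.box 3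 (2 * n)) x y} (fun _ => (1 : ℝ)) ω) ∂(Literature.Probability.Percolation.bondPercolation (Literature.Probability.LatticeModels.zdGraph 3) p)) ^ 2

/-- item stmt-CriticalPhenomena-7062 · support · rank 9 · closed · proved by Summit.CriticalPhenomena.PercolationContinuityZ3.Theorems.lowerTailLadder_proof (prover) · by planner
sources: Grimmett1999, Summits/CriticalPhenomena/PercolationContinuityZ3/Ideas/self-averaging-binder-criterion.md
[support] ArmMassLowerTail → ArmMassNSA (card ladder, spelled out). Proof: at every n with P(M_n ≤
E/2) ≥ c (E = E_{p_c}M_n ≥ 0): Var(M_n) = ∫ (M_n − E)² dμ ≥ ∫_{M_n ≤ E/2} (M_n − E)² dμ ≥ P(M_n ≤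
E/2)·(E/2)² ≥ (c/4) E²; so NSA holds with constant c/4 along the same infinitely many n. Needs: M_n
measurable and bounded (finite sum of indicators of measurable events,
DCT16.measurableSet_openConnIn), variance of a bounded r.v. under a probability measure = ∫ (X − E
X)² (ProbabilityTheory.variance_def' or evariance_eq_lintegral_ofReal + integrability of bounded
functions). [difficulty: provable-now] -/
@[route_item "route-CriticalPhenomena-PercNonSelfAveraging"]
def LowerTailLadder : Prop :=
  ArmMassLowerTail → ArmMassNSA

/-- item stmt-CriticalPhenomena-7063 · support · rank 9 · closed · proved by Summit.CriticalPhenomena.PercolationContinuityZ3.Theorems.strictFKGLadder_proof @ 599c8893be48 (prover) · by planner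
sources: Harris1960, Literature.Probability.Percolation.harris_fkg_holds, Literature.Barriers.CriticalPhenomena.exists_oneArmProb_criticalProbI_lower_sq, KozmaNachmias2011, DuminilCopinTassionEM2016
[support] StrictMacroscopicFKG → ArmMassNSA (card ladder 'StrictFKG ⇒ NSA', spelled out with the
comparability step the card omits). Proof: Var(M_n) = Σ_{x,y ∈ B(n)} [P(A_x ∩ A_y) − P(A_x)P(A_y)];
EVERY term is ≥ 0 by Harris–FKG (A_x increasing: harris_fkg_holds / harris_fkg_lower); far pairs (∃
i, 2|x_i−y_i| ≥ n) contribute ≥ c P(A_x)P(A_y) each for n ≥ N. Comparability: for x ∈ B(n), θ_{3n} ≤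
P(A_x) ≤ θ_n (x+B(3n) ⊇ B(2n) ⊇ x+B(n); first-exit arguments as in DCT16.armEvent_of_pathIn,
translation invariance DCT16.real_armEvent), and for each x ∈ B(n) at most n³ ≤ |B(n)|/8 sites y ∈
B(n) are NOT far (all |x_i−y_i| ≤ (n−1)/2), so #far ≥ (7/8)|B(n)|². Hence Var(M_n) ≥ (7c/8)|B(n)|²
θ_{3n}² ≥ (7c/8)(θ_{3n}/θ_n)² (E M_n)². Finally θ_{3n} ≥ θ_n/10 for INFINITELY MANY n: otherwise
θ_{3^k N'} < 10^{−k} for all k, contradicting the PROVED critical lower bound θ_n(p_c) ≥ a/n²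
(Literature.Barriers.CriticalPhenomena.exists_oneArmProb_criticalProbI_lower_sq, d = 3: a/(3^k N')²
= (a/N'²)9^{−k} > 10^{−k} for large k). At those n (all ≥ N eventually) NSA holds with constant
7c/800. [difficulty: provable-now] -/
@[route_item "route-CriticalPhenomena-PercNonSelfAveraging"]
def StrictFKGLadder : Prop :=
  StrictMacroscopicFKG → ArmMassNSA

/-- item stmt-CriticalPhenomena-7064 · support · rank 9 · closed · proved by Summit.CriticalPhenomena.PercolationContinuityZ3.Theorems.annulusLadder_proof (prover) · by planner
sources: NewmanTassionWu2017, Grimmett1999, Summits/CriticalPhenomena/PercolationContinuityZ3/Theses/PercAnnulusCrossing.lean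
[support] CritAnnulusNonCrossing → ArmMassLowerTail, where the antecedent is VERBATIM the crux X_B
of route PercAnnulusCrossing (stmt-CriticalPhenomena-0846: ∃ c > 0, ∀ n ≥ 1, P_{p_c}(∃ x ∈ B(n), ∃ y
∈ ∂^{in}B(2n), x ↔ y inside B(2n)) ≤ 1 − c). Proof: the crossing event is measurable (finite union
of DCT16.measurableSet_openConnIn), so its complement has probability ≥ c (prob_compl_eq_one_sub);
on the complement no x ∈ B(n) is joined to ∂^{in}B(2n) inside B(2n), i.e. every indicator in M_n
vanishes and M_n = 0 ≤ E M_n / 2 (E M_n ≥ 0). Hence P(M_n ≤ E/2) ≥ c for all n ≥ 1, in particular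
frequently. Records that X is weaker than X_B: a proof of stmt-CriticalPhenomena-0846 closes this
route too. [difficulty: provable-now] -/
@[route_item "route-CriticalPhenomena-PercNonSelfAveraging"]
def AnnulusLadder : Prop :=
  (∃ c : ℝ, 0 < c ∧ ∀ n : ℕ, 1 ≤ n → (Literature.Probability.Percolation.bondPercolation (Literature.Probability.LatticeModels.zdGraph 3) (Literature.Probability.Percolation.criticalProbI 3)).real {ω | ∃ x ∈ Literature.Probability.LatticeModels.box 3 n, ∃ y ∈ Literature.Probability.LatticeModels.innerBoundary (Literature.Probability.LatticeModels.zdGraph 3) (Literature.Probability.LatticeModels.box 3 (2 * n)), ω ∈ Literature.Probability.Percolation.openConnIn ↑(Literature.Probability.LatticeModels.box 3 (2 * n)) x y} ≤ 1 - c) → ArmMassLowerTail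

/-- item stmt-CriticalPhenomena-7065 · assembly · rank 1 · closed · proved by Summit.CriticalPhenomena.PercolationContinuityZ3.Theorems.percNonSelfAveraging_assembly_proof @ e539d5869d69 (prover) · by planner
sources: Grimmett1999, FitznerVanDerHofstad2017, Summits/CriticalPhenomena/PercolationContinuityZ3/Ideas/self-averaging-binder-criterion.md
[assembly] SelfAveragingUnderJump → ArmMassNSA → PercolationContinuityZ3 (jump ⇒ self-averaging,
contradicting NSA at p_c). -/
@[route_item "route-CriticalPhenomena-PercNonSelfAveraging"]
def Assembly : Prop :=
  SelfAveragingUnderJump → ArmMassNSA → PercolationContinuityZ3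

/-! D-0027 §2.1 — DECIDING THEOREM (planner-authored via `route open/edit --closes-file`; by planner-rbadge-CriticalPhenomena-PercNonSelfAv-6f06a4c1-g4-0 2026-08-15T16:12:56Z):
its hypotheses are this route's items and its conclusion the sub-problem Statement (glue_lint), and it elaborates with this file. -/

@[closes "route-CriticalPhenomena-PercNonSelfAveraging"] theorem closes (h_SelfAveragingUnderJump : SelfAveragingUnderJump) (h_ArmMassNSA : ArmMassNSA) :
    _root_.PercolationContinuityZ3 := by
  refine Literature.Probability.Percolation.percolationContinuityZ3_iff.mpr ?_
  by_contra hne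
  have h0 : (0 : ℝ) ≤ Literature.Probability.Percolation.theta
      (Literature.Probability.LatticeModels.zdGraph 3) 0
      (Literature.Probability.Percolation.criticalProbI 3) := by
    unfold Literature.Probability.Percolation.theta
    exact MeasureTheory.measureReal_nonneg
  have hpos := lt_of_le_of_ne h0 (Ne.symm hne)
  obtain ⟨c, hc, hfreq⟩ := h_ArmMassNSA
  obtain ⟨n, hle, hlt⟩ :=
    (hfreq.and_eventually (h_SelfAveragingUnderJump _ hpos c hc)).exists
  exact absurd hlt (not_lt.mpr hle)

end Summit.CriticalPhenomena.PercolationContinuityZ3.Theses.PercNonSelfAveraging
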